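/-
Copyright (c) 2026 the pub-hodgecm-mathlib formalisation cell (harness21).  Prover seat hodgecm-mathlib-LH4-p13 (g8), req620 Track A «(D-RAM) FOUR-FRAME» squad, tier 0,
STAGE-1b (dealer LH4-plan (g13) WORD #66 (3); LH4-p05 (g8) ★ p859970 №7 `CleanLabelDichotomyLawAt` (A″), producer LH4-p13): brick (L-lab-19a) «THE EXPLICIT TOP OF THE
CLEAN-SHELL HNF VERTEX» (dealer WORD #91 (a)): ★ p860285's trichotomy made EXPLICIT — either the `v⁰`-entry `A` is on top with the explicit Gram–Schmidt triple
`(Ve₀, V(−κ,1,0), Ve₂)`, `κ = B∕A`, or `b = 0`, `|D₀| = 1` and the `v¹`-entry `C` is on top.  2026-09-04.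
-/
import Summits.HodgeConjecture.HodgeConjecture.Theorems.F0P3cDyRamHNFDiagonalTriple           -- ★ p860285 (this seat, (L-lab-17c)); brings ★ p860236 (17b) `c_add_le_of_clean_shell`, `not_cross_top`, ★ p860186 (17a), ★ `dualisable_strata`
import HarnessLib

/-!
# Crux `H413`, line LH4 «(D-RAM) FOUR-FRAME», STAGE-1b — (L-lab-19a) «THE EXPLICIT TOP OF THE CLEAN-SHELL HNF VERTEX»

Cell `hodgecm-mathlib` (D-0151), FLOOR 0, crux item H413 = `stmt-HodgeConjecture-24833`, route of record `HCCMUnconditional`; squad F0∕P3c∕LH4.  THEOREMS ONLY (no `def`, no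
instance, no notation, no `sorry`, default heartbeats), ★-only imports, lane `--supports stmt-HodgeConjecture-24833`.

THE MATHEMATICS.  Normalised HNF lattice `L = V·𝒪³`, `V = [[1,0,0],[x,ϖ^b,0],[y,z,ϖ^c]]` (`x y z ∈ 𝒪`), self-dual for a `σ`-fixed non-degenerate `diag D`; `T = diag(α, β, 1)`,
`α, β ∈ E¹`, `X = diag(α−1, β−1, 0)`; `S(w, w′) = D₀σ(w₀)(α−1)w′₀ + D₁σ(w₁)(β−1)w′₁ = ⟨w, Xw′⟩_D`.  Columns `v⁰ = (1,x,y)`, `v¹ = (0,ϖ^b,z)`, `v² = (0,0,ϖ^c)`; S-Gram entries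
`A = S(v⁰,v⁰)`, `B = S(v⁰,v¹)`, `B′ = S(v¹,v⁰)`, `C = S(v¹,v¹)` (the `v²` row and column vanish).
* HEAD `explicit_top_of_clean_shell_latt_hnf` — under ★ p860285's clean-shell hypotheses: EITHER `|A| = |ϖ^ℓ|` (`A = D₀(α−1) + D₁σx(β−1)x = S(v⁰,v⁰)`) with the explicit
  triple `(Ve₀, V(−κ,1,0), Ve₂)`, `κA = B`, `|κ| ≤ 1`, generating `L`, second value `≤ |ϖ^m|`; OR `|A| ≤ |ϖ^{ℓ+1}|`, `b = 0`, `|C| = |ϖ^ℓ|` (`C = D₁σ(ϖ^b)(β−1)ϖ^b = S(v¹,v¹)`)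
  and `|D₀| = 1`.  Same proof as ★ p860285, with the branches' data exported instead of ∃-packed (dealer WORD #91 (a): the consumers B2b-1∕B2b-2 need the class BY NAME).

HONEST LABEL: count-neutral; these are the (A″) engines on the HNF model; the transport to `CleanLabelDichotomyLawAt` (★ №7) is (L-lab-18).  HC_CM remains proved only modulo the printed
citations (2 remaining named inputs: hLiu418 = `stmt-HodgeConjecture-24832`, h413 = `stmt-HodgeConjecture-24833`) until rung 0 closes.
-/

noncomputable section

namespace Summit.HodgeConjecture.HodgeConjecture.Cruxes.H413.F0P3cDyRamHNFExplicitTop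

open Literature.NumberTheory.Automorphic Literature.NumberTheory.Automorphic.HermitianLattice Literature.NumberTheory.Automorphic.UnitaryGroup
open Literature.NumberTheory.Automorphic.UnitaryLatticeTree Literature.NumberTheory.Automorphic.UnitaryThreeFourFrame
open Summit.HodgeConjecture.HodgeConjecture.Cruxes.H413.F0P3cDyRamFourFramePieces
open Summit.HodgeConjecture.HodgeConjecture.Cruxes.H413.F0P3cDyRamFourFrameCensusDefs
open Summit.HodgeConjecture.HodgeConjecture.Cruxes.H413.F0P3cDyRamDiagonalTorusDefs
open Summit.HodgeConjecture.HodgeConjecture.Cruxes.H413.F0P3cDyRamDiagonalStableLatticeHNF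
open Summit.HodgeConjecture.HodgeConjecture.Cruxes.H413.F0P3cDyRamDiagonalHNFDualFrameValues (dualFrame_values gram_values)
open Summit.HodgeConjecture.HodgeConjecture.Cruxes.H413.F0P3cDyRamDiagonalDualisableStrata (dualisable_strata)
open Summit.HodgeConjecture.HodgeConjecture.Cruxes.H413.F0P3cDyRamLevelTokenHNF (latticeInLevel_iff_forall_smul_mulVec_mem latticeInLevel_diagonal_latt_hnf_iff)
open Summit.HodgeConjecture.HodgeConjecture.Cruxes.H413.F0P3cDyRamUniformizerPowerTube (v_pow_eq_exp_neg)
open Summit.HodgeConjecture.HodgeConjecture.Cruxes.H413.F0P3cDyRamModelSquareLevelClean (pairing_diagonal_three smul_diagonal_mulVec_apply)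
open Summit.HodgeConjecture.HodgeConjecture.Cruxes.H413.F0P3cDyRamHNFCrossGram
open Summit.HodgeConjecture.HodgeConjecture.Cruxes.H413.F0P3cDyRamHNFCleanShellArith
open scoped Valued WithZero Matrix MatrixGroups
open WithZero

variable {K : Type} [Field K] [Valued K ℤᵐ⁰]

/-! ## HEAD — the explicit top -/

/-- **THE EXPLICIT TOP OF A CLEAN-SHELL NORMALISED HNF VERTEX.**  Hypotheses of ★ p860285 `exists_triple_of_clean_shell_latt_hnf`.  Conclusion: EITHER the `v⁰`-diagonal
S-Gram entry `A = D₀(α−1) + D₁σx(β−1)x` has `|A| = |ϖ^ℓ|` and the Gram–Schmidt vector `y₂ = V(−κ, 1, 0)` (`κA = B = D₁σx(β−1)ϖ^b`, `|κ| ≤ 1`) lies in `L`, generates `L` with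
`Ve₀, Ve₂`, and has `|S(y₂, y₂)| ≤ |ϖ^m|`; OR `|A| ≤ |ϖ^{ℓ+1}|`, `b = 0`, `|C| = |ϖ^ℓ|` (`C = S(v¹,v¹)`) and `|D₀| = 1` (strata core∕T₁).  The cross entry is never alone on top
(★ p860236 `not_cross_top`). [cite: Kottwitz1986BaseChangeUnits, §1 pp. 240–241] [cite: Jacobowitz1962, §4, §7] [cite: Rogawski1990, §4.9 Prop. 4.9.1 (b) p. 55] -/
theorem explicit_top_of_clean_shell_latt_hnf {σ : K →+* K} {ϖ : K} {d t : ℕ} (hDat : IsRamifiedQuadraticDatum σ ϖ d t)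
    {D : Fin 3 → K} (hDσ : ∀ i, σ (D i) = D i) (hD0 : ∀ i, D i ≠ 0) {b c : ℕ} {x y z : K} (hx : Valued.v x ≤ 1) (hy : Valued.v y ≤ 1) (hz : Valued.v z ≤ 1)
    (hn : IsNormalisedLattice (latt (Matrix.of ![![1, 0, 0], ![x, ϖ ^ b, 0], ![y, z, ϖ ^ c]])))
    (hM : IsVertexLattice σ ϖ (Matrix.diagonal D) 0 (latt (Matrix.of ![![1, 0, 0], ![x, ϖ ^ b, 0], ![y, z, ϖ ^ c]])))
    {α β : K} {N₀ n₁ n₂ n₃ : ℕ} (hE : IsElementDatum σ ϖ N₀ α β n₁ n₂ n₃) {ℓ m mc : ℕ} (hℓN : ℓ + 1 ≤ N₀) (hmN : m ≤ N₀) (hℓmc : 2 * ℓ + 1 ≤ mc) (hmmc : m + ℓ ≤ mc)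
    (hlev : LatticeInLevel ϖ ℓ (Matrix.diagonal ![α - 1, β - 1, 0]) (latt (Matrix.of ![![1, 0, 0], ![x, ϖ ^ b, 0], ![y, z, ϖ ^ c]])))
    (hnlev : ¬ LatticeInLevel ϖ (ℓ + 1) (Matrix.diagonal ![α - 1, β - 1, 0]) (latt (Matrix.of ![![1, 0, 0], ![x, ϖ ^ b, 0], ![y, z, ϖ ^ c]])))
    (hsq : LatticeInLevel ϖ mc (Matrix.diagonal ![(α - 1) * (α - 1), (β - 1) * (β - 1), 0]) (latt (Matrix.of ![![1, 0, 0], ![x, ϖ ^ b, 0], ![y, z, ϖ ^ c]]))) :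
    (Valued.v (D 0 * (α - 1) + D 1 * σ x * ((β - 1) * x)) = Valued.v (ϖ ^ ℓ) ∧
      ∃ κ : K, Valued.v κ ≤ 1 ∧ κ * (D 0 * (α - 1) + D 1 * σ x * ((β - 1) * x)) = D 1 * σ x * ((β - 1) * ϖ ^ b) ∧
        (Matrix.of ![![1, 0, 0], ![x, ϖ ^ b, 0], ![y, z, ϖ ^ c]]) *ᵥ ![-κ, 1, 0] ∈ latt (Matrix.of ![![1, 0, 0], ![x, ϖ ^ b, 0], ![y, z, ϖ ^ c]]) ∧
        (∀ w ∈ latt (Matrix.of ![![1, 0, 0], ![x, ϖ ^ b, 0], ![y, z, ϖ ^ c]]), ∃ a b' c' : K, Valued.v a ≤ 1 ∧ Valued.v b' ≤ 1 ∧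
          ∀ i, w i = a * ((Matrix.of ![![1, 0, 0], ![x, ϖ ^ b, 0], ![y, z, ϖ ^ c]]) *ᵥ ![1, 0, 0]) i + b' * ((Matrix.of ![![1, 0, 0], ![x, ϖ ^ b, 0], ![y, z, ϖ ^ c]]) *ᵥ ![-κ, 1, 0]) i + c' * ((Matrix.of ![![1, 0, 0], ![x, ϖ ^ b, 0], ![y, z, ϖ ^ c]]) *ᵥ ![0, 0, 1]) i) ∧
        Valued.v (D 0 * σ (((Matrix.of ![![1, 0, 0], ![x, ϖ ^ b, 0], ![y, z, ϖ ^ c]]) *ᵥ ![-κ, 1, 0]) 0) * ((α - 1) * ((Matrix.of ![![1, 0, 0], ![x, ϖ ^ b, 0], ![y, z, ϖ ^ c]]) *ᵥ ![-κ, 1, 0]) 0) +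
          D 1 * σ (((Matrix.of ![![1, 0, 0], ![x, ϖ ^ b, 0], ![y, z, ϖ ^ c]]) *ᵥ ![-κ, 1, 0]) 1) * ((β - 1) * ((Matrix.of ![![1, 0, 0], ![x, ϖ ^ b, 0], ![y, z, ϖ ^ c]]) *ᵥ ![-κ, 1, 0]) 1)) ≤ Valued.v (ϖ ^ m)) ∨
    (Valued.v (D 0 * (α - 1) + D 1 * σ x * ((β - 1) * x)) ≤ Valued.v (ϖ ^ (ℓ + 1)) ∧ b = 0 ∧
      Valued.v (D 1 * σ (ϖ ^ b) * ((β - 1) * ϖ ^ b)) = Valued.v (ϖ ^ ℓ) ∧ Valued.v (D 0) = 1) := by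
  obtain ⟨hσ, hvσ, hϖ, hfix, -, -, -⟩ := hDat
  obtain ⟨-, -, -, -, -, hn₁v, hn₂v, hn₃v, hN₁, hN₂, -⟩ := hE
  have hϖ0 : ϖ ≠ 0 := (Valuation.ne_zero_iff Valued.v).1 (by rw [hϖ]; exact exp_ne_zero)
  have hq : ∀ n : ℕ, Valued.v (ϖ ^ n) = exp (-(n : ℤ)) := v_pow_eq_exp_neg hϖ
  have hq1 : ∀ n : ℕ, Valued.v (ϖ ^ n) ≤ 1 := fun n => by rw [hq, ← exp_zero, exp_le_exp]; omega
  have hq_one : ∀ n : ℕ, Valued.v (ϖ ^ n) = 1 → n = 0 := fun n h => by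
    rw [hq, ← exp_zero, exp_inj] at h; omega
  have hpb : (ϖ ^ b : K) ≠ 0 := pow_ne_zero _ hϖ0
  have hpc : (ϖ ^ c : K) ≠ 0 := pow_ne_zero _ hϖ0
  have hu : Valued.v (α - 1) = exp (-(n₂ : ℤ)) := by rw [hn₂v, ← map_pow, hq]
  have hw : Valued.v (β - 1) = exp (-(n₁ : ℤ)) := by rw [hn₁v, ← map_pow, hq]
  -- self-duality ⇒ integrality of the form on `L`
  have hdet : IsUnit (Matrix.diagonal D).det := by
    rw [Matrix.det_diagonal, isUnit_iff_ne_zero]; exact Finset.prod_ne_zero_iff.2 fun i _ => hD0 i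
  have hdual := dualLatt_eq_self_of_isSelfDualLattice hvσ hdet hM
  have hint : ∀ w ∈ latt (Matrix.of ![![1, 0, 0], ![x, ϖ ^ b, 0], ![y, z, ϖ ^ c]]), ∀ w' ∈ latt (Matrix.of ![![1, 0, 0], ![x, ϖ ^ b, 0], ![y, z, ϖ ^ c]]),
      Valued.v (pairing σ (Matrix.diagonal D) w w') ≤ 1 := fun w hw w' hw' => by
    have h := hw'; rw [← hdual, mem_dualLatt] at h; exact h w hw
  -- the dual-frame values and the normalisation letters
  obtain ⟨hD2, ⟨hD1ge, -, hD1⟩, ⟨hD0ge, -, -, hD0v3⟩⟩ := dualFrame_values hvσ hϖ hD0 b c hx hy hz hn hM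
  obtain ⟨-, -, hdetG⟩ := gram_values hvσ hϖ0 D b c x y z hM
  have hvD0 : Valued.v (D 0) ≠ 0 := (Valuation.ne_zero_iff _).2 (hD0 0)
  have hvD1 : Valued.v (D 1) ≠ 0 := (Valuation.ne_zero_iff _).2 (hD0 1)
  obtain ⟨hnx, hnyz⟩ := (normalised_latt_hnf_iff hx hy hz (hq1 b) (hq1 c)).1 hn
  have hbx : 1 ≤ b → Valued.v x = 1 := fun hb => hnx.resolve_left fun h => by have := hq_one b h; omega
  have hnorm : Valued.v y = 1 ∨ Valued.v z = 1 ∨ c = 0 := by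
    rcases hnyz with h | h | h
    · exact Or.inr (Or.inr (hq_one c h))
    · exact Or.inl h
    · exact Or.inr (Or.inl h)
  -- the level letters
  have hlev6 := (latticeInLevel_diagonal_latt_hnf_iff hϖ0 ℓ ![α - 1, β - 1, 0] x y z hpb hpc).1 hlev
  simp only [Matrix.cons_val_zero, Matrix.cons_val_one, Matrix.cons_val_two, Matrix.tail_cons, Matrix.head_cons] at hlev6
  obtain ⟨-, -, -, h4, h5, h6⟩ := hlev6
  have hsq6' := (latticeInLevel_diagonal_latt_hnf_iff hϖ0 mc ![(α - 1) * (α - 1), (β - 1) * (β - 1), 0] x y z hpb hpc).1 hsq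
  simp only [Matrix.cons_val_zero, Matrix.cons_val_one, Matrix.cons_val_two, Matrix.tail_cons, Matrix.head_cons] at hsq6'
  obtain ⟨-, -, -, -, -, hsq6⟩ := hsq6'
  -- the basis vectors and their S-Gram entries
  have hv0 : (Matrix.of ![![1, 0, 0], ![x, ϖ ^ b, 0], ![y, z, ϖ ^ c]]) *ᵥ ![1, 0, 0] ∈ latt (Matrix.of ![![1, 0, 0], ![x, ϖ ^ b, 0], ![y, z, ϖ ^ c]]) :=
    mulVec_three_mem_latt _ (by simp) (by simp) (by simp)
  have hv1 : (Matrix.of ![![1, 0, 0], ![x, ϖ ^ b, 0], ![y, z, ϖ ^ c]]) *ᵥ ![0, 1, 0] ∈ latt (Matrix.of ![![1, 0, 0], ![x, ϖ ^ b, 0], ![y, z, ϖ ^ c]]) :=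
    mulVec_three_mem_latt _ (by simp) (by simp) (by simp)
  obtain ⟨h00, h01, h02⟩ := mulVec_hnf_apply x y z (ϖ ^ b) (ϖ ^ c) (1 : K) 0 0
  obtain ⟨h10, h11, h12⟩ := mulVec_hnf_apply x y z (ϖ ^ b) (ϖ ^ c) (0 : K) 1 0
  obtain ⟨h20, h21, -⟩ := mulVec_hnf_apply x y z (ϖ ^ b) (ϖ ^ c) (0 : K) 0 1
  have hAle : Valued.v (D 0 * (α - 1) + D 1 * σ x * ((β - 1) * x)) ≤ Valued.v (ϖ ^ ℓ) := by
    have h := v_cross_le_of_latticeInLevel_of_integral (σ := σ) hϖ0 hint hlev hv0 hv0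
    rw [h00, h01] at h; simpa using h
  have hBle : Valued.v (D 1 * σ x * ((β - 1) * ϖ ^ b)) ≤ Valued.v (ϖ ^ ℓ) := by
    have h := v_cross_le_of_latticeInLevel_of_integral (σ := σ) hϖ0 hint hlev hv0 hv1
    rw [h00, h01, h10, h11] at h; simpa using h
  have hB'le : Valued.v (D 1 * σ (ϖ ^ b) * ((β - 1) * x)) ≤ Valued.v (ϖ ^ ℓ) := by
    have h := v_cross_le_of_latticeInLevel_of_integral (σ := σ) hϖ0 hint hlev hv1 hv0
    rw [h00, h01, h10, h11] at h; simpa using h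
  have hCle : Valued.v (D 1 * σ (ϖ ^ b) * ((β - 1) * ϖ ^ b)) ≤ Valued.v (ϖ ^ ℓ) := by
    have h := v_cross_le_of_latticeInLevel_of_integral (σ := σ) hϖ0 hint hlev hv1 hv1
    rw [h10, h11] at h; simpa using h
  have hBB' : Valued.v (D 1 * σ x * ((β - 1) * ϖ ^ b)) = Valued.v (D 1 * σ (ϖ ^ b) * ((β - 1) * x)) := by
    simp only [map_mul, hvσ, mul_comm, mul_assoc, mul_left_comm]
  have hgt := exists_gram_gt_of_not_latticeInLevel hvσ hϖ0 hdual hnlev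
  -- `|D₀|·|D₁| = exp(2b + c)`
  have hD01 : Valued.v (D 0) * Valued.v (D 1) = exp (2 * (b : ℤ) + c) := by
    have h := hdetG
    simp only [map_mul, hvσ, hq, hD2] at h
    rw [← exp_log hvD0, ← exp_log hvD1] at h ⊢
    simp only [← exp_add, exp_eq_one] at h
    rw [← exp_add, exp_inj]
    omega
  by_cases hA : Valued.v (ϖ ^ (ℓ + 1)) < Valued.v (D 0 * (α - 1) + D 1 * σ x * ((β - 1) * x))
  · -- ### CASE A: the `v⁰`-entry is on top — triple A
    have hAeq := eq_of_le_of_gt_succ hϖ hAle hA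
    have hA0 : D 0 * (α - 1) + D 1 * σ x * ((β - 1) * x) ≠ 0 := fun h => by
      rw [h, map_zero] at hAeq; exact (Valuation.ne_zero_iff Valued.v).2 (pow_ne_zero ℓ hϖ0) hAeq.symm
    set κ : K := D 1 * σ x * ((β - 1) * ϖ ^ b) / (D 0 * (α - 1) + D 1 * σ x * ((β - 1) * x)) with hκdef
    have hκA : κ * (D 0 * (α - 1) + D 1 * σ x * ((β - 1) * x)) = D 1 * σ x * ((β - 1) * ϖ ^ b) := by rw [hκdef, div_mul_cancel₀ _ hA0]
    have hκ : Valued.v κ ≤ 1 := by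
      rw [hκdef, map_div₀, div_le_one₀ (zero_lt_iff.2 ((Valuation.ne_zero_iff _).2 hA0)), hAeq]; exact hBle
    obtain ⟨-, h22⟩ := triple_A_values σ D α β x y z (ϖ ^ b) (ϖ ^ c) hA0 hκA
    have hy₂ : (Matrix.of ![![1, 0, 0], ![x, ϖ ^ b, 0], ![y, z, ϖ ^ c]]) *ᵥ ![-κ, 1, 0] ∈ latt (Matrix.of ![![1, 0, 0], ![x, ϖ ^ b, 0], ![y, z, ϖ ^ c]]) :=
      mulVec_three_mem_latt _ (by rw [Valuation.map_neg]; exact hκ) (le_of_eq (map_one _)) (by rw [map_zero]; exact zero_le)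
    refine Or.inl ⟨hAeq, κ, hκ, hκA, hy₂, fun w hw => exists_coords_shear₀ _ hκ hw, ?_⟩
    have hQ := c_add_le_of_clean_shell hϖ hn₂v hn₁v hnorm h5 h6 hsq6 (hmN.trans hN₁) (hmN.trans hN₂) (by omega) hmmc
    rw [h22, map_div₀, hAeq, div_le_iff₀ (zero_lt_iff.2 ((Valuation.ne_zero_iff _).2 (pow_ne_zero ℓ hϖ0)))]
    simp only [map_mul, hvσ, hu, hw, hq]
    rw [hD01]
    simp only [← exp_add, exp_le_exp]
    omega
  · by_cases hC : Valued.v (ϖ ^ (ℓ + 1)) < Valued.v (D 1 * σ (ϖ ^ b) * ((β - 1) * ϖ ^ b))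
    · -- ### CASE C: the `v¹`-entry is on top (and `A` is not) — then `b = 0`, triple C
      have hCeq := eq_of_le_of_gt_succ hϖ hCle hC
      have hb0 : b = 0 := by
        by_contra hb
        have hx1 : Valued.v x = 1 := hbx (by omega)
        -- `|C| = |B′|·|ϖ^b| < |B′| ≤ |ϖ^ℓ|`
        have hCB : Valued.v (D 1 * σ (ϖ ^ b) * ((β - 1) * ϖ ^ b)) = Valued.v (D 1 * σ (ϖ ^ b) * ((β - 1) * x)) * Valued.v (ϖ ^ b) := by
          simp only [map_mul, hx1, one_mul, mul_comm, mul_assoc]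
        have hlt : Valued.v (D 1 * σ (ϖ ^ b) * ((β - 1) * ϖ ^ b)) < Valued.v (ϖ ^ ℓ) := by
          rw [hCB]
          calc Valued.v (D 1 * σ (ϖ ^ b) * ((β - 1) * x)) * Valued.v (ϖ ^ b) ≤ Valued.v (ϖ ^ ℓ) * Valued.v (ϖ ^ b) := mul_le_mul_left hB'le _
            _ < Valued.v (ϖ ^ ℓ) := by
              rw [hq, hq, ← exp_add, exp_lt_exp]; omega
        exact (lt_irrefl _) (hCeq ▸ hlt)
      subst hb0
      -- the strata with `b = 0`: core and T₁ give `|D₀| = 1`; T₂ contradicts `C` on top; the glued ones have `b ≥ 1`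
      have hD0one : Valued.v (D 0) = 1 := by
        rcases dualisable_strata hvσ hfix hϖ 0 c hx hy hz hn ⟨D, fun i => ⟨hDσ i, hD0 i⟩, hM⟩ with
          ⟨-, hc0⟩ | ⟨s, hc0, hbs, -, hs2⟩ | ⟨s, -, hcs, -, hs2, hzs, hy1⟩ | ⟨s, -, hcs, -, -, hz1, hyxz⟩ |
          ⟨ρ, s, hρ, -, -, hbρ, -⟩ | ⟨ρ, s, hρ, -, -, hbρ, -⟩ | ⟨ρ, s, hρ, hs2, -, -, hbρs, -⟩ | ⟨ρ, hρ, hbρ, -⟩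
        · -- core: `c = 0`
          subst hc0
          rcases hD0v3 with h | h | h
          · exact h
          · refine le_antisymm ?_ hD0ge
            rw [h]; simpa using hx
          · refine le_antisymm ?_ hD0ge
            rw [h]
            have : Valued.v (x * z - y * ϖ ^ 0) ≤ 1 := by
              rw [pow_zero, mul_one]
              exact (Valuation.map_sub _ _ _).trans (max_le (by rw [map_mul]; exact mul_le_one' hx hz) hy)
            simpa using this
        · omega
        · -- T₂: `|D₁| = 1`, so `|C| = |β − 1| = exp(−n₁) ≠ exp(−ℓ)`
          exfalso
          rw [← hcs] at hzs
          have hD1one : Valued.v (D 1) = 1 := by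
            rcases hD1 with h | h
            · simpa using h
            · refine le_antisymm ?_ (by simpa using hD1ge)
              rw [h]
              calc Valued.v z * exp (((0 : ℕ) : ℤ) + c) ≤ Valued.v (ϖ ^ c) * exp (((0 : ℕ) : ℤ) + c) := mul_le_mul_left hzs _
                _ = 1 := by rw [hq, ← exp_add, ← exp_zero]; congr 1; push_cast; ring
          have h := hCeq
          simp only [pow_zero, map_mul, map_one, mul_one, hD1one, one_mul, hw, hq, exp_inj] at h
          omega
        · -- T₁: `|y − xz| ≤ |ϖ^c|`, so `|D₀| = 1`
          rw [← hcs] at hyxz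
          rcases hD0v3 with h | h | h
          · exact h
          · refine le_antisymm ?_ hD0ge
            rw [h]; simpa using hx
          · refine le_antisymm ?_ hD0ge
            rw [h, show x * z - y * ϖ ^ 0 = -(y - x * z) by rw [pow_zero]; ring, Valuation.map_neg]
            calc Valued.v (y - x * z) * exp (((0 : ℕ) : ℤ) + c) ≤ Valued.v (ϖ ^ c) * exp (((0 : ℕ) : ℤ) + c) := mul_le_mul_left hyxz _
              _ = 1 := by rw [hq, ← exp_add, ← exp_zero]; congr 1; push_cast; ring
        · omega
        · omega
        · omega
        · omega
      exact Or.inr ⟨not_lt.1 hA, rfl, hCeq, hD0one⟩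
    · -- ### the cross entry alone on top: impossible on the clean shell
      exfalso
      have hB' : Valued.v (D 1 * σ (ϖ ^ b) * ((β - 1) * x)) = Valued.v (ϖ ^ ℓ) := by
        rcases hgt with h | h | h | h
        · exact absurd h hA
        · exact eq_of_le_of_gt_succ hϖ hB'le (hBB' ▸ h)
        · exact eq_of_le_of_gt_succ hϖ hB'le h
        · exact absurd h hC
      refine not_cross_top hvσ hϖ hint ?_ ?_ hx hz hbx hn₂v hn₁v hn₃v (by omega) (by omega) hℓmc h4 h6 hsq6 hB' (not_lt.1 hC)
      · rcases hD1 with h | h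
        · exact Or.inl (by rw [h])
        · exact Or.inr (by rw [h])
      · rw [hD2]


end Summit.HodgeConjecture.HodgeConjecture.Cruxes.H413.F0P3cDyRamHNFExplicitTop

end
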